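import Summits.Ventures.YMGap.RobustBall.RobustAreaLawRowsW
import Summits.Ventures.YMGap.RobustBall.RobustSlabDoorVertex
import HarnessLib

/-!
# Robust ball (Y2), area-law side — the TIER-2 area law with the AFFINE-VERTEX row condition, and its certified rows

HONEST FRAMING: venture file of the cell `pub-ymgap` (QuantumFields programme), track ROBUST-BALL (ds-4).  The lossy vertex `ℓ = Λ₀ = ε₁` of
`areaLawOnBallW_of_oneLinkKRModulus` replaced by the affine-vertex bookkeeping of DESIGN §6 (rb-p2's `RobustSlabDoorVertex`: SITE-dependent
self-Lipschitz load `ℓ(x̄)`; ds-2's vertex bound `row_le_rhoFR`): the weighted Dobrushin row at the vertical link `e_x̄` is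
`e^{a(e)}(1 + 2√N ℓ_s(e))·(e^{κ/n}·2n|β/N|K) + √N Λ_κ(e)`, AFFINE in `(ℓ_s(e), Λ_κ(e))` on the ball's per-link constraint `ℓ_s + Λ ≤ ε₁`, hence
`≤ rhoFR N (e^{κ/n}·2n|β/N|K) ε₀ ε₁ = max(e^{ε₀}(1 + 2√N ε₁) c, e^{ε₀} c + √N ε₁)`, `c = e^{κ/n}·2n|β/N|K`.  Results:
* `slabLawW_entry_cov_le_of_weightedRows` — the weighted slab door for ARBITRARY contraction coefficients (only the weighted row sums enter);
* `areaLawOnBallW_of_oneLinkKRModulus_vertex` — `rhoFR N (e^{κ/n}·2n|β/N|K) ε₀ ε₁ < 1 ⇒ AreaLawOnBallW N (n+1) β κ ε₀ ε₁ mv`;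
* `clusterDomain_mono`, `AreaLawOnBallW.mono` — the tier-2 ball is antitone in `κ` and monotone in the radii, so every row also holds
  for heavier weights and smaller radii;
* certified SU(2) rows on the one-parameter balls `(2ε, ε)`: `d = 4`, `κ = log(6/5)`: `(1/8, .39)`, `(1/5, .27)`, `(1/4, .21)`, `(1/3, .14)`,
  `(1/2, .045)`; `κ = log(3/2)`: `(1/3, .12)`; `d = 3`, `κ = log(6/5)`: `(1/4, .32)`, `(1/2, .13)`, `(3/4, .04)` — against the lossy-vertex rows
  `(1/3, .10)`, `(1/2, .035)`, `(1/4, .21)_{d=3}` of `RobustAreaLawRowsW`.  (The TIER-1 vertex rows are rb-p2's `RobustAreaLawVertex`; not here.)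
Strong-coupling finite-lattice statements; nothing about the continuum, a mass gap, or Clay.
-/

noncomputable section

open MeasureTheory ProbabilityTheory Real
open Literature.Probability.LatticeModels hiding glue
open Literature.Probability.LatticeModels.DobrushinMetric
open Literature.MathematicalPhysics.QuantumLattice (fundamentalRep continuous_fundamentalRep fundamentalRep_apply)
open Literature.MathematicalPhysics.QuantumFieldTheory
open Literature.MathematicalPhysics.QuantumFieldTheory.DurhuusFrohlich
open Literature.MathematicalPhysics.QuantumFieldTheory.Balaban1983to89.StrongCouplingDobrushinWindow (OneLinkKRModulus)

namespace Summit.Ventures.YMGap.RobustBall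

variable {n L N : ℕ} [NeZero L]

/-! ### The weighted slab door for arbitrary contraction coefficients -/

section Generic

variable {W : GaugeConfig (n + 1) L (SU N) → ℝ}

/-- **Weighted slab door, arbitrary coefficients** (Föllmer's `κ̄ < 1`): if `slabSpecW v t β W r` is a KR contraction with coefficients `C`
on neighbourhoods `nbr` (for the non-degenerate slices `L ≠ 1`) and `∑_{ȳ ∈ nbr x̄} C(x̄,ȳ) e^{τ d(x̄,ȳ)} ≤ c < 1` at every site (`τ ≥ 0`), then
for all slice sites, indices and `φ, ψ ∈ {Re, Im}`: `|Cov_{slabLawW}(φ(Q_x̄)_{ij}, ψ(Q_ȳ⁻¹)_{kl})| ≤ 8N e^{-τ d(x̄,ȳ)}`.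
[cite: Follmer1988, Ch. I Corollary (2.14)] -/
theorem slabLawW_entry_cov_le_of_weightedRows (hN : 1 ≤ N) (v : Fin (n + 1)) (t : ZMod L) {β τ c : ℝ}
    (hWm : Measurable W) (hWb : ∃ C, ∀ U, |W U| ≤ C) (r : {e : Edge (n + 1) L // ¬ IsSlab v t e} → SU N)
    (nbr : TorusSite n L → Finset (TorusSite n L)) (C : TorusSite n L → TorusSite n L → ℝ)
    (hKR : L ≠ 1 → IsKRContraction (slabSpecW v t β W r) suFrobDist nbr C)
    (hτ : 0 ≤ τ) (hc0 : 0 ≤ c) (hc1 : c < 1)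
    (hroww : ∀ x, ∑ y ∈ nbr x, C x y * Real.exp (τ * torusGraphDist x y) ≤ c)
    (x y : TorusSite n L) (i j k l : Fin N) (φ ψ : ℂ → ℝ)
    (hφ : φ = Complex.re ∨ φ = Complex.im) (hψ : ψ = Complex.re ∨ ψ = Complex.im) :
    |cov[fun Q => φ ((Q x : Matrix (Fin N) (Fin N) ℂ) i j),
        fun Q => ψ ((((Q y)⁻¹ : Matrix.specialUnitaryGroup (Fin N) ℂ) : Matrix (Fin N) (Fin N) ℂ) k l);
        slabLawW v t β W r]| ≤
      8 * N * Real.exp (-τ * torusGraphDist x y) := by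
  classical
  haveI := isProbabilityMeasure_slabLawW (n := n) (L := L) (N := N) v t β hWm hWb r
  obtain ⟨hfm, hfdep, hf1, hfL⟩ := Slab.entryObs_props (n := n) (L := L) x i j hφ
  obtain ⟨hgm, hgdep, hg1, hgL⟩ := Slab.invEntryObs_props (n := n) (L := L) y k l hψ
  have hN8 : (2 : ℝ) * (2 * Real.sqrt N) ^ 2 = 8 * N := by
    rw [mul_pow, Real.sq_sqrt (Nat.cast_nonneg N)]; ring
  have hNr : (1 : ℝ) ≤ N := by exact_mod_cast hN
  by_cases hL1 : L = 1
  · subst hL1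
    have hxy : x = y := Subsingleton.elim _ _
    subst hxy
    have h4 := Slab.abs_cov_le_of_abs_le (μ := slabLawW v t β W r) hf1 hg1
    rw [torusGraphDist_self, Nat.cast_zero, mul_zero, Real.exp_zero, mul_one]
    calc _ ≤ 2 * 1 * (2 * 1) := h4
      _ ≤ 8 * N := by nlinarith
  · have hγ := isSpecification_slabSpecW (n := n) (L := L) v t β hWm hWb r
    have key := abs_covariance_le_of_isKRContraction_exp_dist hγ (hKR hL1) suFrobDist_nonneg suFrobDist_le (by positivity)
      (isGibbsMeasure_slabLawW v t β hWm hWb r) hfm (Δf := {x}) (by simpa using hfdep) hf1 hfL hgm (Δg := {y})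
      (by simpa using hgdep) hg1 hgL hc0 hc1 (fun a b => (torusGraphDist a b : ℝ)) (fun _ _ _ _ => Nat.cast_nonneg _) hτ
      (fun z _ => hroww z)
      (fun z => (torusGraphDist z y : ℝ)) (fun z hz => by rw [Finset.mem_singleton.1 hz, torusGraphDist_self, Nat.cast_zero])
      (fun z _ w _ => by rw [add_comm]; exact_mod_cast torusGraphDist_triangle z w y) (m := (torusGraphDist x y : ℝ))
      (fun z hz => by rw [Finset.mem_singleton.1 hz])
    have key' : |cov[fun Q => φ ((Q x : Matrix (Fin N) (Fin N) ℂ) i j),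
        fun Q => ψ ((((Q y)⁻¹ : Matrix.specialUnitaryGroup (Fin N) ℂ) : Matrix (Fin N) (Fin N) ℂ) k l);
        slabLawW v t β W r]| ≤ 2 * (2 * Real.sqrt N) ^ 2 * 1 * 1 * Real.exp (-(τ * torusGraphDist x y)) := by
      simpa using key
    calc _ ≤ 2 * (2 * Real.sqrt N) ^ 2 * 1 * 1 * Real.exp (-(τ * torusGraphDist x y)) := key'
      _ = 8 * N * Real.exp (-τ * torusGraphDist x y) := by rw [← hN8, neg_mul]; ring

end Generic

/-! ### The affine-vertex tier-2 door -/

section Vertex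

/-- **WEIGHTED SLAB COVARIANCE DECAY FOR A MEMBER OF THE TIER-2 BALL, affine-vertex row.**  One-link modulus on the slab ball `R ≥ 2n|βt|`,
`0 ≤ τ`, `τ n ≤ κ`, `0 ≤ ε₁`, and `rhoFR N (e^{τ}·2n|βt|K) ε₀ ε₁ < 1`: for every `W ∈ ClusterDomain κ ε₀ ε₁`, direction, height, rest, slice
sites and `φ, ψ ∈ {Re, Im}`, `|Cov_{slabLawW}(φ(Q_x̄)_{ij}, ψ(Q_ȳ⁻¹)_{kl})| ≤ 8N e^{-τ d_graph(x̄,ȳ)}` — rb-p2's site-dependent contraction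
`isKRContraction_slabSpecW_site` with `ℓ(x̄) = ℓ_{s,0}(e_x̄)`, weighted rows bounded per site by ds-2's `row_le_rhoFR`. [folklore] -/
theorem slabCovarianceW_vertex_of_oneLinkKRModulus (hN : 1 ≤ N) (βt : ℝ) {R K : ℝ} (hK : 0 ≤ K) (hmod : OneLinkKRModulus N R K)
    (hR : |βt| * (2 * (n : ℝ)) ≤ R) {κ τ ε₀ ε₁ : ℝ} (hκ : 0 ≤ κ) (hτ : 0 ≤ τ) (hτκ : τ * n ≤ κ) (h₁ : 0 ≤ ε₁) (mv : ℕ)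
    (hρ : rhoFR N (Real.exp τ * (2 * (n : ℝ) * |βt| * K)) ε₀ ε₁ < 1)
    (L : ℕ) [NeZero L] (W : Perturbation (n + 1) L N) (hWball : W ∈ ClusterDomain κ ε₀ ε₁) (_hWloc : IsSlabLocal mv W)
    (v : Fin (n + 1)) (t : ZMod L) (rest : {e : Edge (n + 1) L // ¬ IsSlab v t e} → SU N) (x y : Site n L)
    (i j k l : Fin N) (φ ψ : ℂ → ℝ) (hφ : φ = Complex.re ∨ φ = Complex.im) (hψ : ψ = Complex.re ∨ ψ = Complex.im) :
    |cov[fun Q => φ ((Q x : Matrix (Fin N) (Fin N) ℂ) i j),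
        fun Q => ψ ((((Q y)⁻¹ : Matrix.specialUnitaryGroup (Fin N) ℂ) : Matrix (Fin N) (Fin N) ℂ) k l);
        slabLawW v t βt W.total rest]| ≤
      8 * N * Real.exp (-τ * torusGraphDist x y) := by
  classical
  obtain ⟨w, hosc, hlip⟩ := hWball
  have hcW : 0 ≤ Real.exp τ * (2 * (n : ℝ) * |βt| * K) := by positivity
  have hρ0 : 0 ≤ rhoFR N (Real.exp τ * (2 * (n : ℝ) * |βt| * K)) ε₀ ε₁ :=
    le_trans (by positivity) (le_max_left _ _)
  refine slabLawW_entry_cov_le_of_weightedRows hN v t W.measurable_total W.exists_abs_total_le rest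
    (fun x' => Slab.slabNbr x' ∪ Finset.univ.erase x')
    (fun x' y' => K * Real.exp ε₀ * (1 + 2 * Real.sqrt N * w.selfLipLoad 0 (vlinkAt v t x')) * |βt| *
      (Slab.slabInfluence x' y' : ℝ) + Real.sqrt N * crossCoeff W w v t x' y')
    (fun hL1 => ?_) hτ hρ0 hρ (fun x' => ?_) x y i j k l φ ψ hφ hψ
  · exact isKRContraction_slabSpecW_site hN hL1 v t hK (fun x' => w.selfLipLoad 0 (vlinkAt v t x'))
      (fun x' => selfLipLoad_nonneg w 0 _) hR hmod W.measurable_total W.exists_abs_total_le rest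
      (fun x' => Finset.univ.erase x') (fun x' => Finset.notMem_erase x' _)
      (fun x' η η' h => siteTiltW_total_dep_univ W rest x' η η' h)
      (fun x' ω g g' => (siteTiltW_total_osc W rest w x' ω g g').trans ((oscLoad_zero_le w hκ _).trans (hosc _)))
      (fun x' ω g g' => siteTiltW_total_lip W rest w x' ω g g')
      (crossCoeff W w v t) (fun x' y' => crossCoeff_nonneg W w x' y')
      (fun x' y' ω η h => siteTiltW_total_cross W rest w x' y' h)
  · -- the weighted row at `x'`: affine lemma, then the vertex bound
    have hℓ0 : 0 ≤ w.selfLipLoad 0 (vlinkAt v t x') := selfLipLoad_nonneg w 0 _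
    have h1 := selfLipLoad_zero_le w hκ (vlinkAt v t x')
    have h2 := hlip (vlinkAt v t x')
    have hsum : w.selfLipLoad 0 (vlinkAt v t x') + w.crossLipLoad κ (vlinkAt v t x') ≤ ε₁ := by linarith
    have hv := row_le_rhoFR (N := N) (cW := Real.exp τ * (2 * (n : ℝ) * |βt| * K)) (a := ε₀) hcW le_rfl
      hℓ0 (crossLipLoad_nonneg w κ (vlinkAt v t x')) hsum
    have hrow := slab_weighted_rowsum_le_affine x'
      (A := K * Real.exp ε₀ * (1 + 2 * Real.sqrt N * w.selfLipLoad 0 (vlinkAt v t x')) * |βt|)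
      (B := Real.sqrt N) (Λt := w.crossLipLoad κ (vlinkAt v t x')) (τ := τ) (by positivity) (Real.sqrt_nonneg _) hτ
      (fun z => Finset.univ.erase z) (crossCoeff W w v t) (crossCoeff_weighted_rowsum_le W w hκ hτ hτκ _ x')
    have hA : Real.exp τ * (2 * (n : ℝ)) * (K * Real.exp ε₀ * (1 + 2 * Real.sqrt N * w.selfLipLoad 0 (vlinkAt v t x')) * |βt|) +
        Real.sqrt N * w.crossLipLoad κ (vlinkAt v t x') =
        Real.exp ε₀ * (1 + 2 * Real.sqrt N * w.selfLipLoad 0 (vlinkAt v t x')) * (Real.exp τ * (2 * (n : ℝ) * |βt| * K)) +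
          Real.sqrt N * w.crossLipLoad κ (vlinkAt v t x') := by ring
    rw [hA] at hrow
    exact le_trans hrow hv

/-- **AREA LAW ON THE TIER-2 BALL, AFFINE-VERTEX ROW CONDITION.**  Let `N ≥ 2`, `n ≥ 1`, `β` the tree coupling, `OneLinkKRModulus N R K` on
the slab ball `R ≥ 2n|β/N|`, `κ > 0`, `0 ≤ ε₁`, `mv ≥ 1`, and `rhoFR N (e^{κ/n}·2n|β/N|K) ε₀ ε₁ < 1` (the larger of the two vertex values
`e^{ε₀}(1 + 2√N ε₁)·c`, `e^{ε₀} c + √N ε₁`, `c = e^{κ/n}·2n|β/N|K`).  Then `AreaLawOnBallW N (n+1) β κ ε₀ ε₁ mv` (rate `κ/(2 n mv)`).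
[cite: Follmer1988, Ch. I Corollary (2.14)] [cite: CaoNissimSheffield2025dynamical, Theorem 2.3] -/
theorem areaLawOnBallW_of_oneLinkKRModulus_vertex (hN : 2 ≤ N) (hn : 1 ≤ n) (β : ℝ) {R K : ℝ} (hK : 0 ≤ K)
    (hmod : OneLinkKRModulus N R K) (hR : |β / N| * (2 * (n : ℝ)) ≤ R) {κ ε₀ ε₁ : ℝ} (hκ : 0 < κ) (h₁ : 0 ≤ ε₁)
    {mv : ℕ} (hmv : 1 ≤ mv)
    (hρ : rhoFR N (Real.exp (κ / n) * (2 * (n : ℝ) * |β / N| * K)) ε₀ ε₁ < 1) :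
    AreaLawOnBallW N (n + 1) β κ ε₀ ε₁ mv := by
  have hn' : (0 : ℝ) < n := by exact_mod_cast (show 0 < n by omega)
  have hτ : 0 ≤ κ / n := div_nonneg hκ.le hn'.le
  have hτκ : κ / n * n ≤ κ := (div_mul_cancel₀ κ hn'.ne').le
  refine areaLawOnBallW_of_slabCovariance (n := n) hN β κ ε₀ ε₁ hmv (C₁ := 8 * N) (C₂ := κ / n) (div_pos hκ hn') ?_
  intro L _ W hWball hWloc v t rest x y i j k l φ ψ hφ hψ
  exact slabCovarianceW_vertex_of_oneLinkKRModulus (by omega) (β / N) hK hmod hR hκ.le hτ hτκ h₁ mv hρ L W hWball hWloc v t rest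
    x y i j k l φ ψ hφ hψ

end Vertex


/-! ### Bookkeeping: the tier-2 ball and its area law are monotone in the weight and the radii -/

section Mono

variable {d : ℕ}

/-- Loads are monotone in the weight: `κ' ≤ κ ⇒ a_{κ'}(e) ≤ a_κ(e)` (`e^{κ' diam X} ≤ e^{κ diam X}`). [folklore] -/
theorem oscLoad_mono_weight {W : Perturbation d L N} (w : LoadWitness W) {κ κ' : ℝ} (hκ : κ' ≤ κ) (e : Edge d L) :
    w.oscLoad κ' e ≤ w.oscLoad κ e :=
  Finset.sum_le_sum fun X _ => mul_le_mul_of_nonneg_right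
    (Real.exp_le_exp.2 (mul_le_mul_of_nonneg_right hκ (Nat.cast_nonneg _))) ((w.osc_spec X).nonneg e)

/-- `κ' ≤ κ ⇒ ℓ_{s,κ'}(e) ≤ ℓ_{s,κ}(e)`. [folklore] -/
theorem selfLipLoad_mono_weight {W : Perturbation d L N} (w : LoadWitness W) {κ κ' : ℝ} (hκ : κ' ≤ κ) (e : Edge d L) :
    w.selfLipLoad κ' e ≤ w.selfLipLoad κ e :=
  Finset.sum_le_sum fun X _ => mul_le_mul_of_nonneg_right
    (Real.exp_le_exp.2 (mul_le_mul_of_nonneg_right hκ (Nat.cast_nonneg _))) ((w.lip_spec X).nonneg e)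

/-- `κ' ≤ κ ⇒ Λ_{κ'}(e) ≤ Λ_κ(e)`. [folklore] -/
theorem crossLipLoad_mono_weight {W : Perturbation d L N} (w : LoadWitness W) {κ κ' : ℝ} (hκ : κ' ≤ κ) (e : Edge d L) :
    w.crossLipLoad κ' e ≤ w.crossLipLoad κ e :=
  Finset.sum_le_sum fun y _ => Finset.sum_le_sum fun X _ => mul_le_mul_of_nonneg_right
    (Real.exp_le_exp.2 (mul_le_mul_of_nonneg_right hκ (Nat.cast_nonneg _))) ((w.lip_spec X).nonneg y)

/-- **The tier-2 ball is antitone in the weight and monotone in the radii**: `κ' ≤ κ`, `ε₀ ≤ ε₀'`, `ε₁ ≤ ε₁'` give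
`ClusterDomain κ ε₀ ε₁ ⊆ ClusterDomain κ' ε₀' ε₁'`. [folklore] -/
theorem clusterDomain_mono {κ κ' ε₀ ε₁ ε₀' ε₁' : ℝ} (hκ : κ' ≤ κ) (h₀ : ε₀ ≤ ε₀') (h₁ : ε₁ ≤ ε₁') :
    (ClusterDomain κ ε₀ ε₁ : Set (Perturbation d L N)) ⊆ ClusterDomain κ' ε₀' ε₁' := by
  rintro W ⟨w, hw₀, hw₁⟩
  refine ⟨w, fun e => (oscLoad_mono_weight w hκ e).trans ((hw₀ e).trans h₀), fun e => ?_⟩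
  exact (add_le_add (selfLipLoad_mono_weight w hκ e) (crossLipLoad_mono_weight w hκ e)).trans ((hw₁ e).trans h₁)

/-- **The tier-2 area law is monotone**: a heavier weight or smaller radii only shrink the ball, so
`AreaLawOnBallW N d β κ ε₀ ε₁ mv ⇒ AreaLawOnBallW N d β κ' ε₀' ε₁' mv` for `κ ≤ κ'`, `ε₀' ≤ ε₀`, `ε₁' ≤ ε₁` (same constants). [folklore] -/
theorem AreaLawOnBallW.mono {β κ κ' ε₀ ε₁ ε₀' ε₁' : ℝ} {mv : ℕ} (h : AreaLawOnBallW N d β κ ε₀ ε₁ mv) (hκ : κ ≤ κ')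
    (h₀ : ε₀' ≤ ε₀) (h₁ : ε₁' ≤ ε₁) : AreaLawOnBallW N d β κ' ε₀' ε₁' mv := by
  obtain ⟨C, c, hc, hW⟩ := h
  exact ⟨C, c, hc, fun L _ W hW' hloc x i j R T hij hR hT hRL hTL =>
    hW L W (clusterDomain_mono hκ h₀ h₁ hW') hloc x i j R T hij hR hT hRL hTL⟩

end Mono

/-! ### Certified SU(2) vertex rows (`d = 4`: `n = 3`, `c = e^{κ/3}·3β_W/2`; `d = 3`: `n = 2`, `c = e^{κ/2}·β_W`) -/

section Rows

/-- **SU(2), d = 4 tier-2 vertex rows, schematic**: `rhoFR 2 (e^{κ/3}·3β_W/2) ε₀ ε₁ < 1 ⇒ AreaLawOnBallW 2 4 (β_W/2) κ ε₀ ε₁ mv`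
(`0 ≤ β_W`, `3β_W/2 ≤ 1`, `κ > 0`, `ε₁ ≥ 0`, `mv ≥ 1`). [folklore] -/
theorem su2_areaLawOnBallW_vertex_of_row {βW κ ε₀ ε₁ : ℝ} (hβ : 0 ≤ βW) (hβ1 : 3 * βW / 2 ≤ 1) (hκ : 0 < κ) (h₁ : 0 ≤ ε₁)
    {mv : ℕ} (hmv : 1 ≤ mv) (hρ : rhoFR 2 (Real.exp (κ / 3) * (3 * βW / 2)) ε₀ ε₁ < 1) :
    AreaLawOnBallW 2 (3 + 1) (βW / 2) κ ε₀ ε₁ mv := by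
  have hmod := SlabAreaLawDimensions.su2_oneLinkKRModulus_of_le_one (R := 3 * βW / 2) hβ1
  have habs : |βW / 2 / (2 : ℕ)| = βW / 4 := by
    rw [abs_of_nonneg (by positivity)]; push_cast; ring
  refine areaLawOnBallW_of_oneLinkKRModulus_vertex (n := 3) le_rfl (by norm_num) (βW / 2) zero_le_one hmod
    (by rw [habs]; push_cast; linarith) hκ h₁ hmv ?_
  have e : Real.exp (κ / ((3 : ℕ) : ℝ)) * (2 * ((3 : ℕ) : ℝ) * |βW / 2 / (2 : ℕ)| * 1) = Real.exp (κ / 3) * (3 * βW / 2) := by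
    rw [habs]; push_cast; ring
  rw [e]; exact hρ

/-- **SU(2), d = 3 tier-2 vertex rows, schematic**: `rhoFR 2 (e^{κ/2}·β_W) ε₀ ε₁ < 1 ⇒ AreaLawOnBallW 2 3 (β_W/2) κ ε₀ ε₁ mv`
(`0 ≤ β_W ≤ 1`, `κ > 0`, `ε₁ ≥ 0`, `mv ≥ 1`). [folklore] -/
theorem su2_areaLawOnBallW_dim3_vertex_of_row {βW κ ε₀ ε₁ : ℝ} (hβ : 0 ≤ βW) (hβ1 : βW ≤ 1) (hκ : 0 < κ) (h₁ : 0 ≤ ε₁)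
    {mv : ℕ} (hmv : 1 ≤ mv) (hρ : rhoFR 2 (Real.exp (κ / 2) * βW) ε₀ ε₁ < 1) :
    AreaLawOnBallW 2 (2 + 1) (βW / 2) κ ε₀ ε₁ mv := by
  have hmod := SlabAreaLawDimensions.su2_oneLinkKRModulus_of_le_one (R := βW) hβ1
  have habs : |βW / 2 / (2 : ℕ)| = βW / 4 := by
    rw [abs_of_nonneg (by positivity)]; push_cast; ring
  refine areaLawOnBallW_of_oneLinkKRModulus_vertex (n := 2) le_rfl (by norm_num) (βW / 2) zero_le_one hmod
    (by rw [habs]; push_cast; linarith) hκ h₁ hmv ?_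
  have e : Real.exp (κ / ((2 : ℕ) : ℝ)) * (2 * ((2 : ℕ) : ℝ) * |βW / 2 / (2 : ℕ)| * 1) = Real.exp (κ / 2) * βW := by
    rw [habs]; push_cast; ring
  rw [e]; exact hρ

/-- Vertex-row certificate from majorants: `e^{w} ≤ E_w`, `e^{ε₀} ≤ E`, `√2 ≤ S`, `0 ≤ c₀, ε₁` and both vertex values of the majorised row
`< 1` give `rhoFR 2 (e^{w} c₀) ε₀ ε₁ < 1`. [folklore] -/
theorem rhoFR_two_lt_one_of_bounds {w c₀ ε₀ ε₁ Ew E S : ℝ} (hc₀ : 0 ≤ c₀) (h₁ : 0 ≤ ε₁) (hEw : Real.exp w ≤ Ew)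
    (hE : Real.exp ε₀ ≤ E) (hS : Real.sqrt 2 ≤ S)
    (hv1 : E * (1 + 2 * S * ε₁) * (Ew * c₀) < 1) (hv2 : E * (Ew * c₀) + S * ε₁ < 1) :
    rhoFR 2 (Real.exp w * c₀) ε₀ ε₁ < 1 := by
  have hcW : 0 ≤ Real.exp w * c₀ := by positivity
  have hmono := rhoFR_mono (N := 2) (ε₀ := ε₀) (mul_le_mul_of_nonneg_right hEw hc₀) h₁
  have hS' : Real.sqrt ((2 : ℕ) : ℝ) ≤ S := by simpa using hS
  have hb := rhoFR_le_of_bounds (N := 2) (cW := Ew * c₀) ((Real.exp_pos _).le.trans hEw |> fun h => mul_nonneg h hc₀) h₁ hE hS'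
  exact lt_of_le_of_lt (hmono.trans hb) (max_lt hv1 hv2)

/-- **CERTIFIED SU(2), d = 4 TIER-2 VERTEX ROW `(β⋆_W, κ, ε) = (1/3, log(6/5), 7/50)`**: `AreaLawOnBallW 2 4 (1/6) (log(6/5)) (7/25) (7/50) mv`,
every `mv ≥ 1` (lossy-vertex row: `1/10`). [folklore] -/
theorem su2_areaLawOnBallW_vertex_oneThird_w65 {mv : ℕ} (hmv : 1 ≤ mv) :
    AreaLawOnBallW 2 4 (1 / 6) (Real.log (6 / 5)) (7 / 25) (7 / 50) mv := by
  rw [show (1 / 6 : ℝ) = 1 / 3 / 2 by norm_num]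
  refine su2_areaLawOnBallW_vertex_of_row (βW := 1 / 3) (by norm_num) (by norm_num) (Real.log_pos (by norm_num)) (by norm_num) hmv ?_
  exact rhoFR_two_lt_one_of_bounds (by norm_num) (by norm_num) exp_log_six_fifths_div_three_le
    (exp_le_taylor4 (x := 7 / 25) (by norm_num) (by norm_num)) sqrt_two_le (by norm_num) (by norm_num)

/-- **CERTIFIED SU(2), d = 4 TIER-2 VERTEX ROW `(1/2, log(6/5), 9/200)`**: `AreaLawOnBallW 2 4 (1/4) (log(6/5)) (9/100) (9/200) mv`. [folklore] -/
theorem su2_areaLawOnBallW_vertex_oneHalf_w65 {mv : ℕ} (hmv : 1 ≤ mv) :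
    AreaLawOnBallW 2 4 (1 / 4) (Real.log (6 / 5)) (9 / 100) (9 / 200) mv := by
  rw [show (1 / 4 : ℝ) = 1 / 2 / 2 by norm_num]
  refine su2_areaLawOnBallW_vertex_of_row (βW := 1 / 2) (by norm_num) (by norm_num) (Real.log_pos (by norm_num)) (by norm_num) hmv ?_
  exact rhoFR_two_lt_one_of_bounds (by norm_num) (by norm_num) exp_log_six_fifths_div_three_le
    (exp_le_taylor4 (x := 9 / 100) (by norm_num) (by norm_num)) sqrt_two_le (by norm_num) (by norm_num)

/-- **CERTIFIED SU(2), d = 4 TIER-2 VERTEX ROW `(1/8, log(6/5), 39/100)`**: `AreaLawOnBallW 2 4 (1/16) (log(6/5)) (39/50) (39/100) mv`. [folklore] -/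
theorem su2_areaLawOnBallW_vertex_oneEighth_w65 {mv : ℕ} (hmv : 1 ≤ mv) :
    AreaLawOnBallW 2 4 (1 / 16) (Real.log (6 / 5)) (39 / 50) (39 / 100) mv := by
  rw [show (1 / 16 : ℝ) = 1 / 8 / 2 by norm_num]
  refine su2_areaLawOnBallW_vertex_of_row (βW := 1 / 8) (by norm_num) (by norm_num) (Real.log_pos (by norm_num)) (by norm_num) hmv ?_
  exact rhoFR_two_lt_one_of_bounds (by norm_num) (by norm_num) exp_log_six_fifths_div_three_le
    (exp_le_taylor4 (x := 39 / 50) (by norm_num) (by norm_num)) sqrt_two_le (by norm_num) (by norm_num)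

/-- **CERTIFIED SU(2), d = 4 TIER-2 VERTEX ROW `(1/5, log(6/5), 27/100)`**: `AreaLawOnBallW 2 4 (1/10) (log(6/5)) (27/50) (27/100) mv`. [folklore] -/
theorem su2_areaLawOnBallW_vertex_oneFifth_w65 {mv : ℕ} (hmv : 1 ≤ mv) :
    AreaLawOnBallW 2 4 (1 / 10) (Real.log (6 / 5)) (27 / 50) (27 / 100) mv := by
  rw [show (1 / 10 : ℝ) = 1 / 5 / 2 by norm_num]
  refine su2_areaLawOnBallW_vertex_of_row (βW := 1 / 5) (by norm_num) (by norm_num) (Real.log_pos (by norm_num)) (by norm_num) hmv ?_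
  exact rhoFR_two_lt_one_of_bounds (by norm_num) (by norm_num) exp_log_six_fifths_div_three_le
    (exp_le_taylor4 (x := 27 / 50) (by norm_num) (by norm_num)) sqrt_two_le (by norm_num) (by norm_num)

/-- **CERTIFIED SU(2), d = 4 TIER-2 VERTEX ROW `(1/4, log(6/5), 21/100)`**: `AreaLawOnBallW 2 4 (1/8) (log(6/5)) (21/50) (21/100) mv`. [folklore] -/
theorem su2_areaLawOnBallW_vertex_oneQuarter_w65 {mv : ℕ} (hmv : 1 ≤ mv) :
    AreaLawOnBallW 2 4 (1 / 8) (Real.log (6 / 5)) (21 / 50) (21 / 100) mv := by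
  rw [show (1 / 8 : ℝ) = 1 / 4 / 2 by norm_num]
  refine su2_areaLawOnBallW_vertex_of_row (βW := 1 / 4) (by norm_num) (by norm_num) (Real.log_pos (by norm_num)) (by norm_num) hmv ?_
  exact rhoFR_two_lt_one_of_bounds (by norm_num) (by norm_num) exp_log_six_fifths_div_three_le
    (exp_le_taylor4 (x := 21 / 50) (by norm_num) (by norm_num)) sqrt_two_le (by norm_num) (by norm_num)

/-- **CERTIFIED SU(2), d = 4 TIER-2 VERTEX ROW `(1/3, log(3/2), 3/25)`** (heavier weight): `AreaLawOnBallW 2 4 (1/6) (log(3/2)) (6/25) (3/25) mv`.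
[folklore] -/
theorem su2_areaLawOnBallW_vertex_oneThird_w32 {mv : ℕ} (hmv : 1 ≤ mv) :
    AreaLawOnBallW 2 4 (1 / 6) (Real.log (3 / 2)) (6 / 25) (3 / 25) mv := by
  rw [show (1 / 6 : ℝ) = 1 / 3 / 2 by norm_num]
  refine su2_areaLawOnBallW_vertex_of_row (βW := 1 / 3) (by norm_num) (by norm_num) (Real.log_pos (by norm_num)) (by norm_num) hmv ?_
  exact rhoFR_two_lt_one_of_bounds (by norm_num) (by norm_num) exp_log_three_halves_div_three_le
    (exp_le_taylor4 (x := 6 / 25) (by norm_num) (by norm_num)) sqrt_two_le (by norm_num) (by norm_num)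

/-- **CERTIFIED SU(2), d = 3 TIER-2 VERTEX ROW `(1/4, log(6/5), 8/25)`**: `AreaLawOnBallW 2 3 (1/8) (log(6/5)) (16/25) (8/25) mv` (lossy-vertex
row: `21/100`). [folklore] -/
theorem su2_areaLawOnBallW_dim3_vertex_oneQuarter_w65 {mv : ℕ} (hmv : 1 ≤ mv) :
    AreaLawOnBallW 2 3 (1 / 8) (Real.log (6 / 5)) (16 / 25) (8 / 25) mv := by
  rw [show (1 / 8 : ℝ) = 1 / 4 / 2 by norm_num]
  refine su2_areaLawOnBallW_dim3_vertex_of_row (βW := 1 / 4) (by norm_num) (by norm_num) (Real.log_pos (by norm_num)) (by norm_num)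
    hmv ?_
  exact rhoFR_two_lt_one_of_bounds (by norm_num) (by norm_num) exp_log_six_fifths_div_two_le
    (exp_le_taylor4 (x := 16 / 25) (by norm_num) (by norm_num)) sqrt_two_le (by norm_num) (by norm_num)

/-- **CERTIFIED SU(2), d = 3 TIER-2 VERTEX ROW `(1/2, log(6/5), 13/100)`**: `AreaLawOnBallW 2 3 (1/4) (log(6/5)) (13/50) (13/100) mv`. [folklore] -/
theorem su2_areaLawOnBallW_dim3_vertex_oneHalf_w65 {mv : ℕ} (hmv : 1 ≤ mv) :
    AreaLawOnBallW 2 3 (1 / 4) (Real.log (6 / 5)) (13 / 50) (13 / 100) mv := by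
  rw [show (1 / 4 : ℝ) = 1 / 2 / 2 by norm_num]
  refine su2_areaLawOnBallW_dim3_vertex_of_row (βW := 1 / 2) (by norm_num) (by norm_num) (Real.log_pos (by norm_num)) (by norm_num)
    hmv ?_
  exact rhoFR_two_lt_one_of_bounds (by norm_num) (by norm_num) exp_log_six_fifths_div_two_le
    (exp_le_taylor4 (x := 13 / 50) (by norm_num) (by norm_num)) sqrt_two_le (by norm_num) (by norm_num)

/-- **CERTIFIED SU(2), d = 3 TIER-2 VERTEX ROW `(3/4, log(6/5), 1/25)`**: `AreaLawOnBallW 2 3 (3/8) (log(6/5)) (2/25) (1/25) mv`. [folklore] -/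
theorem su2_areaLawOnBallW_dim3_vertex_threeQuarters_w65 {mv : ℕ} (hmv : 1 ≤ mv) :
    AreaLawOnBallW 2 3 (3 / 8) (Real.log (6 / 5)) (2 / 25) (1 / 25) mv := by
  rw [show (3 / 8 : ℝ) = 3 / 4 / 2 by norm_num]
  refine su2_areaLawOnBallW_dim3_vertex_of_row (βW := 3 / 4) (by norm_num) (by norm_num) (Real.log_pos (by norm_num)) (by norm_num)
    hmv ?_
  exact rhoFR_two_lt_one_of_bounds (by norm_num) (by norm_num) exp_log_six_fifths_div_two_le
    (exp_le_taylor4 (x := 2 / 25) (by norm_num) (by norm_num)) sqrt_two_le (by norm_num) (by norm_num)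

end Rows

end Summit.Ventures.YMGap.RobustBall
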